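import Summits.CriticalPhenomena.CardyFormulaZ2.Theorems.CardyBoundaryCoulombGasRectilinearCardyStubRowBlocksPart3
import Summits.CriticalPhenomena.CardyFormulaZ2.Theorems.CardyBoundaryCoulombGasRectilinearCardyStubReverseInsert
import Summits.CriticalPhenomena.CardyFormulaZ2.Theorems.CardyBoundaryCoulombGasRectilinearCardyStubOrientationPart1
import HarnessLib

/-!
# Stub B `stub_rowBlocks` of line `excursion-kernel-covariance`, part 13: the reversed domain of a
# clockwise conformal rectangle, its frames and tangential signs
# (crux `RectilinearCardy`, stmt-CriticalPhenomena-5660, route `CardyBoundaryCoulombGas`)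

Continuum set-up of the ROW BLOCKS stub, first half:

* `rb_reverse` — the REVERSED Jordan domain `D` of a conformal rectangle `R` (same carrier, loop
  `t ↦ ∂R(m₀ + m₃ - t)`; `stub_reverseInsert`), and `rb_reverse_oriented` — if `R` is clockwise at the
  flat mark `a` then `D` is positively oriented at `a = ∂D(m₃)` in the sense of the BOUNDARY FEET stub;
* `rb_frames` — ONE flat radius `rf` with the window frame (`kwl_exists_windowFrame`) along the
  reversed window `[c₀ - σ₂', c₀ - σ₂]` and frames at the marks `b = ∂D(c₀ - m₁)`, `a = ∂D(m₃)`,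
  `d = ∂D(m₀ + 1)` (`exists_orient_of_flat`), `c₀ = m₀ + m₃`;
* `rb_theta` — a parameter scale `θ` below a given gap on which the loop moves by `< rf/8`;
* `rb_sign_window`, `rb_sign_mark` — tangential signs of the loop along the window and at a mark
  (`kwl_strictMonoOn_or_strictAntiOn_tng`, `rb_T_sign`).

All [folklore].
-/

noncomputable section

open Set Metric
open Literature.Probability.RandomPlanarGeometry
open Literature.Probability.LatticeModels (Orient)
open Summit.CriticalPhenomena.CardyFormulaZ2.Cruxes.BoundaryDefectGaussianR.RainbowMonomialsInExcursionKernels (tp_unif_cont)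

namespace Summit.CriticalPhenomena.CardyFormulaZ2.Cruxes.RectilinearCardy.ExcursionKernelCovariance

/-! ### The reversed domain -/

/-- **The reversed Jordan domain** of a conformal rectangle: same carrier, loop `t ↦ ∂R(m₀ + m₃ - t)`.
[folklore] -/
theorem rb_reverse (R : ConformalRectangle) :
    ∃ D : JordanDomain, D.carrier = R.carrier ∧ ∀ t : ℝ, D.boundary t = R.boundary (R.mark 0 + R.mark 3 - t) := by
  have h13 : R.mark 1 < R.mark 3 := R.strictMono_mark (show (1 : Fin 4) < 3 by decide)
  obtain ⟨D, hDc, hDb, -⟩ := stub_reverseInsert R ((R.mark 1 + R.mark 3) / 2) (by linarith) (by linarith)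
  exact ⟨D.toJordanDomain, hDc, hDb⟩

/-- **A clockwise rectangle reversed is positively oriented at `a`.** If near `mark 0` the loop of
`R` moves in the axis direction `u` with the carrier to the RIGHT, then the reversed loop moves in the
direction `-u` from `a = ∂D(m₃)` with the carrier to the LEFT of it, i.e. along `(-u) i`. [folklore] -/
theorem rb_reverse_oriented (R : ConformalRectangle) (D : JordanDomain) (hDc : D.carrier = R.carrier)
    (hDb : ∀ t : ℝ, D.boundary t = R.boundary (R.mark 0 + R.mark 3 - t))
    (hcw : ∃ u : ℂ, (u = 1 ∨ u = Complex.I ∨ u = -1 ∨ u = -Complex.I) ∧ ∃ r : ℝ, 0 < r ∧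
      (∀ t t' : ℝ, R.mark 0 - r < t → t < t' → t' < R.mark 0 + r →
        0 < ((R.boundary t' - R.boundary t) / u).re ∧ ((R.boundary t' - R.boundary t) / u).im = 0) ∧
      (∀ z : ℂ, dist z (R.pt 0) < r → (z ∈ R.carrier ↔ 0 < -((z - R.pt 0) / u).im))) :
    ∃ t₁ : ℝ, ∃ τ : ℂ, ‖τ‖ = 1 ∧
      (∃ ε : ℝ, 0 < ε ∧ ∀ t ∈ Ioo t₁ (t₁ + ε), ∃ s : ℝ, 0 < s ∧ D.boundary t = D.boundary t₁ + (s : ℂ) * τ) ∧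
      (∃ ε : ℝ, 0 < ε ∧ ∀ s ∈ Ioo (0 : ℝ) ε, D.boundary t₁ + (s : ℂ) * (τ * Complex.I) ∈ D.carrier) := by
  obtain ⟨u, hu, r, hr, hfwd, hside⟩ := hcw
  have hu1 : ‖u‖ = 1 := ori_norm_eq_one hu
  have hu0 : u ≠ 0 := fun h => by rw [h, norm_zero] at hu1; exact zero_ne_one hu1
  have ha : D.boundary (R.mark 3) = R.pt 0 := by rw [hDb]; simp [MarkedDomain.pt]
  refine ⟨R.mark 3, -u, by rw [norm_neg, hu1], ⟨r, hr, fun t ht => ?_⟩, ⟨r, hr, fun s hs => ?_⟩⟩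
  · -- forward motion of the reversed loop
    set tR : ℝ := R.mark 0 + R.mark 3 - t with htR
    obtain ⟨hre, him⟩ := hfwd tR (R.mark 0) (by rw [htR]; linarith [ht.2]) (by rw [htR]; linarith [ht.1]) (by linarith)
    set q : ℂ := (R.boundary (R.mark 0) - R.boundary tR) / u with hq
    refine ⟨q.re, hre, ?_⟩
    have hqre : q = ((q.re : ℝ) : ℂ) := Complex.ext (by simp) (by simp [him])
    have hmul : q * u = R.boundary (R.mark 0) - R.boundary tR := by rw [hq, div_mul_cancel₀ _ hu0]
    rw [hDb t, ha, ← htR]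
    have : R.boundary tR = R.pt 0 - q * u := by rw [hmul]; simp [MarkedDomain.pt]
    have hq' : q * u = ((q.re : ℝ) : ℂ) * u := by nth_rewrite 1 [hqre]; rfl
    rw [this, hq']
    ring
  · -- the carrier lies to the left of the reversed direction
    rw [hDc, ha, hside]
    · have : (R.pt 0 + (s : ℂ) * (-u * Complex.I) - R.pt 0) / u = -((s : ℂ) * Complex.I) := by
        field_simp; ring
      rw [this]
      simp
      exact hs.1
    · rw [dist_eq_norm, add_sub_cancel_left, norm_mul, norm_mul, norm_neg, hu1, Complex.norm_I, Complex.norm_real,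
        Real.norm_eq_abs, abs_of_pos hs.1]
      linarith [hs.2]

/-! ### Frames along the window and at the marks -/

/-- **One flat radius for the window and the three marks**, read on the reversed loop: the window
frame (`Ω̄ = {nrmC ow ≥ Hw}` near every point `∂D(t)`, `t ∈ [c₀ - σ₂', c₀ - σ₂]`, all of height `Hw`)
and frames at `b = ∂D(c₀ - m₁) = pt 1`, `a = ∂D(m₃) = pt 0`, `d = ∂D(m₀ + 1) = pt 3`. [folklore] -/
theorem rb_frames (R : ConformalRectangle) (D : JordanDomain) (hDc : D.carrier = R.carrier)
    (hDb : ∀ t : ℝ, D.boundary t = R.boundary (R.mark 0 + R.mark 3 - t)) (hFlat : FlatMarks R)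
    {σ₂ σ₂' : ℝ} (hadm₂ : AdmissibleRange R σ₂ σ₂') :
    ∃ (ow ob oa od : Orient) (Hw rf : ℝ), 0 < rf ∧
      (∀ t ∈ Icc (R.mark 0 + R.mark 3 - σ₂') (R.mark 0 + R.mark 3 - σ₂), Orient.nrmC ow (D.boundary t) = Hw ∧
        (∀ z, dist z (D.boundary t) < rf → (z ∈ closure D.carrier ↔ Hw ≤ Orient.nrmC ow z)) ∧
        (∀ z, dist z (D.boundary t) < rf → (z ∈ D.carrier ↔ Hw < Orient.nrmC ow z))) ∧
      ((∀ z, dist z (D.boundary (R.mark 0 + R.mark 3 - R.mark 1)) < rf →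
          (z ∈ closure D.carrier ↔ Orient.nrmC ob (D.boundary (R.mark 0 + R.mark 3 - R.mark 1)) ≤ Orient.nrmC ob z)) ∧
        (∀ z, dist z (D.boundary (R.mark 0 + R.mark 3 - R.mark 1)) < rf →
          (z ∈ D.carrier ↔ Orient.nrmC ob (D.boundary (R.mark 0 + R.mark 3 - R.mark 1)) < Orient.nrmC ob z))) ∧
      ((∀ z, dist z (D.boundary (R.mark 3)) < rf → (z ∈ closure D.carrier ↔ Orient.nrmC oa (D.boundary (R.mark 3)) ≤ Orient.nrmC oa z)) ∧
        (∀ z, dist z (D.boundary (R.mark 3)) < rf → (z ∈ D.carrier ↔ Orient.nrmC oa (D.boundary (R.mark 3)) < Orient.nrmC oa z))) ∧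
      ((∀ z, dist z (D.boundary (R.mark 0 + 1)) < rf → (z ∈ closure D.carrier ↔ Orient.nrmC od (D.boundary (R.mark 0 + 1)) ≤ Orient.nrmC od z)) ∧
        (∀ z, dist z (D.boundary (R.mark 0 + 1)) < rf → (z ∈ D.carrier ↔ Orient.nrmC od (D.boundary (R.mark 0 + 1)) < Orient.nrmC od z))) ∧
      D.boundary (R.mark 0 + R.mark 3 - R.mark 1) = R.pt 1 ∧ D.boundary (R.mark 3) = R.pt 0 ∧ D.boundary (R.mark 0 + 1) = R.pt 3 := by
  -- the three marks on the reversed loop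
  have hb : D.boundary (R.mark 0 + R.mark 3 - R.mark 1) = R.pt 1 := by rw [hDb]; simp [MarkedDomain.pt]
  have ha : D.boundary (R.mark 3) = R.pt 0 := by rw [hDb]; simp [MarkedDomain.pt]
  have hd : D.boundary (R.mark 0 + 1) = R.pt 3 := by
    rw [hDb, show R.mark 0 + R.mark 3 - (R.mark 0 + 1) = R.mark 3 - 1 by ring]
    have := R.periodic_boundary.sub_eq (R.mark 3)
    rw [this]; rfl
  -- the window frame
  obtain ⟨ow, Hw, rw, hrw, hwin⟩ := kwl_exists_windowFrame R hadm₂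
  -- frames at the marks
  have hmk : ∀ i : Fin 4, ∃ (o : Orient) (r : ℝ), 0 < r ∧
      (∀ z, dist z (R.pt i) < r → (z ∈ closure R.carrier ↔ Orient.nrmC o (R.pt i) ≤ Orient.nrmC o z)) ∧
      (∀ z, dist z (R.pt i) < r → (z ∈ R.carrier ↔ Orient.nrmC o (R.pt i) < Orient.nrmC o z)) := by
    intro i
    obtain ⟨r, hr, hflat⟩ := hFlat i
    obtain ⟨o, ho⟩ := Literature.Probability.LatticeModels.exists_orient_of_flat R.toJordanDomain (R.pt_mem_frontier i) hr hflat
    exact ⟨o, r, hr, ho⟩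
  obtain ⟨ob, r1, hr1, hcl1, hop1⟩ := hmk 1
  obtain ⟨oa, r0, hr0, hcl0, hop0⟩ := hmk 0
  obtain ⟨od, r3, hr3, hcl3, hop3⟩ := hmk 3
  set rf : ℝ := min (min rw r1) (min r0 r3) with hrf
  have hrf0 : 0 < rf := lt_min (lt_min hrw hr1) (lt_min hr0 hr3)
  have hrfw : rf ≤ rw := (min_le_left _ _).trans (min_le_left _ _)
  have hrf1 : rf ≤ r1 := (min_le_left _ _).trans (min_le_right _ _)
  have hrf0' : rf ≤ r0 := (min_le_right _ _).trans (min_le_left _ _)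
  have hrf3 : rf ≤ r3 := (min_le_right _ _).trans (min_le_right _ _)
  refine ⟨ow, ob, oa, od, Hw, rf, hrf0, fun t ht => ?_, ?_, ?_, ?_, hb, ha, hd⟩
  · have ht' : R.mark 0 + R.mark 3 - t ∈ Icc σ₂ σ₂' := ⟨by linarith [ht.2], by linarith [ht.1]⟩
    obtain ⟨h1, h2, h3⟩ := hwin _ ht'
    rw [hDb t, hDc]
    exact ⟨h1, fun z hz => h2 z (lt_of_lt_of_le hz hrfw), fun z hz => h3 z (lt_of_lt_of_le hz hrfw)⟩
  · rw [hb, hDc]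
    exact ⟨fun z hz => hcl1 z (lt_of_lt_of_le hz hrf1), fun z hz => hop1 z (lt_of_lt_of_le hz hrf1)⟩
  · rw [ha, hDc]
    exact ⟨fun z hz => hcl0 z (lt_of_lt_of_le hz hrf0'), fun z hz => hop0 z (lt_of_lt_of_le hz hrf0')⟩
  · rw [hd, hDc]
    exact ⟨fun z hz => hcl3 z (lt_of_lt_of_le hz hrf3), fun z hz => hop3 z (lt_of_lt_of_le hz hrf3)⟩

/-! ### A parameter scale for the flat radius -/

/-- **A parameter scale `θ`** below a given bound on which the loop moves by less than `rf / 8`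
(uniform continuity, `tp_unif_cont`). [folklore] -/
theorem rb_theta (D : JordanDomain) {rf g : ℝ} (hrf : 0 < rf) (hg : 0 < g) :
    ∃ θ : ℝ, 0 < θ ∧ θ ≤ g ∧ ∀ s t : ℝ, |s - t| ≤ 2 * θ → dist (D.boundary s) (D.boundary t) < rf / 8 := by
  obtain ⟨d, hd, hcont⟩ := tp_unif_cont D (ε := rf / 8) (by positivity)
  refine ⟨min (d / 4) g, lt_min (by positivity) hg, min_le_right _ _, fun s t hst => hcont s t ?_⟩
  have := min_le_left (d / 4) g
  linarith

/-! ### Tangential signs -/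

/-- **The tangential sign along the window**, read on the reversed loop: the tangential coordinate
`T(t) = tngC ow (∂D(t))` is strictly monotone with a sign `sTw` on the reversed window (it is strictly
monotone along the window of `R`, `kwl_strictMonoOn_or_strictAntiOn_tng`). [folklore] -/
theorem rb_sign_window (R : ConformalRectangle) (D : JordanDomain)
    (hDb : ∀ t : ℝ, D.boundary t = R.boundary (R.mark 0 + R.mark 3 - t)) {ow : Orient} {Hw σ₂ σ₂' : ℝ}
    (h1 : R.mark 1 < σ₂) (hσσ' : σ₂ ≤ σ₂') (h3 : σ₂' < R.mark 3)
    (hh : ∀ t ∈ Icc (R.mark 0 + R.mark 3 - σ₂') (R.mark 0 + R.mark 3 - σ₂), Orient.nrmC ow (D.boundary t) = Hw) :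
    ∃ sTw : ℝ, (sTw = 1 ∨ sTw = -1) ∧
      ∀ t ∈ Icc (R.mark 0 + R.mark 3 - σ₂') (R.mark 0 + R.mark 3 - σ₂), ∀ t' ∈ Icc (R.mark 0 + R.mark 3 - σ₂') (R.mark 0 + R.mark 3 - σ₂),
        t < t' → 0 < sTw * (Orient.tngC ow (D.boundary t') - Orient.tngC ow (D.boundary t)) := by
  have hhR : ∀ t ∈ Icc σ₂ σ₂', Orient.nrmC ow (R.boundary t) = Hw := by
    intro t ht
    have := hh (R.mark 0 + R.mark 3 - t) ⟨by linarith [ht.2], by linarith [ht.1]⟩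
    rwa [hDb, show R.mark 0 + R.mark 3 - (R.mark 0 + R.mark 3 - t) = t by ring] at this
  have hmem : ∀ t ∈ Icc (R.mark 0 + R.mark 3 - σ₂') (R.mark 0 + R.mark 3 - σ₂), R.mark 0 + R.mark 3 - t ∈ Icc σ₂ σ₂' :=
    fun t ht => ⟨by linarith [ht.2], by linarith [ht.1]⟩
  rcases kwl_strictMonoOn_or_strictAntiOn_tng R h1 hσσ' h3 hhR with hmono | hanti
  · refine ⟨-1, Or.inr rfl, fun t ht t' ht' htt' => ?_⟩
    have := hmono (hmem t' ht') (hmem t ht) (by linarith)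
    simp only at this
    rw [hDb t, hDb t']
    linarith
  · refine ⟨1, Or.inl rfl, fun t ht t' ht' htt' => ?_⟩
    have := hanti (hmem t' ht') (hmem t ht) (by linarith)
    simp only at this
    rw [hDb t, hDb t']
    linarith

/-- **The tangential sign at a flat mark** `∂D(t₀)` on the scale `2θ` (`rb_T_sign` with the frame at
the mark and the motion bound of `rb_theta`). [folklore] -/
theorem rb_sign_mark (D : JordanDomain) {o : Orient} {h rf t₀ θ : ℝ} (hθ : 0 < θ) (hθ1 : 4 * θ < 1)
    (hcl : ∀ z, dist z (D.boundary t₀) < rf → (z ∈ closure D.carrier ↔ h ≤ Orient.nrmC o z))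
    (hop : ∀ z, dist z (D.boundary t₀) < rf → (z ∈ D.carrier ↔ h < Orient.nrmC o z))
    (hmove : ∀ s t : ℝ, |s - t| ≤ 2 * θ → dist (D.boundary s) (D.boundary t) < rf / 8) :
    ∃ sT : ℝ, (sT = 1 ∨ sT = -1) ∧ ∀ t t' : ℝ, |t - t₀| ≤ 2 * θ → |t' - t₀| ≤ 2 * θ → t < t' →
      0 < sT * (Orient.tngC o (D.boundary t') - Orient.tngC o (D.boundary t)) := by
  have hrf : 0 < rf := by
    have := hmove t₀ t₀ (by simp; linarith)
    linarith [dist_nonneg (x := D.boundary t₀) (y := D.boundary t₀)]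
  exact rb_T_sign D (θ := 2 * θ) (by linarith) (by linarith) hcl hop fun t ht => by
    have := hmove t t₀ ht; linarith

end Summit.CriticalPhenomena.CardyFormulaZ2.Cruxes.RectilinearCardy.ExcursionKernelCovariance

end
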